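import Literature.MathematicalPhysics.QuantumFieldTheory.Balaban1983to89.B11Prop6Concrete
import Summits.QuantumFields.YangMills.Theorems.UnitScaleTiltProp7SectET3Objects
import HarnessLib

/-!
# Route `UnitScaleTilt`, crux K1 child «MinimiserStabilityRegPr» (stmt-QuantumFields-19200), stub `stub_existenceMinimalOrbit` (EX), route (α) — (S2-obj) + P6@T³ WITH THE
# PERIODS ABSTRACT: the rows of `UnitScaleTiltProp7SectET3Objects` (p596145) re-stated for an ARBITRARY period vector `Pd : Fin d → ℕ` of lit-balaban's lattice `TSite d Pd`,
# so that they instantiate at the LATTICE OF RECORD `towerP F.L m (K−n)` (OWNER RULING (J) 2026-08-28T02:14:16Z, chart `siteEquivTower`) as well as at `periodsT3 F K`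

Cell `ym3-torus`, width seat `ym-ust-19200-w2` (gen 2).  YM₃ on T³ is a ladder rung (R3), not the Clay problem; nothing here claims the stub, the crux, d = 4 or the mass gap.
`--supports stmt-QuantumFields-19200 --as helper`; count-neutral.

WHY THIS FILE.  p596145's §1–§3 are abstract in the site chart `e` but FIX the periods `Pd ≡ (F.P K).sitesPerDir 0`; the Literature pair `(H̃_{1,k}, C_k)` and `W80` —
hence the T³ `SectEDatum` instance — are typed on `Bond d (towerP L m (K−n))` (★w4-20520 g2, 02:13:56Z (J)), whose periods equal `periodsT3 F K` only propositionally
(`2L^{F.m+n}·L^{K−n} = 2L^{F.m+K}`).  Append-only forbids re-signing p596145, so the same rows are re-proved here VERBATIM with `{Pd : Fin (F.P K).d → ℕ}` implicit and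
`e : Site (F.P K) 0 ≃ TSite (F.P K).d Pd` — no proof uses the value of `Pd`.  The `_tower` specialisations (`e := siteEquivTower`) follow ★w5-20520's
`…Prop7SectET3TransportTower` by `exact`, exactly as p596145 §4 specialises at `e := siteEquiv F K`.

THE PRINT, THE OBJECTS, WHAT IS PROVED: as in `UnitScaleTiltProp7SectET3Objects` (same names, namespace `…Prop7SectET3ObjectsPd`): §1 `isUnitaryBg_T3`, `tsh_apply`,
`tsh_symm_apply`, `plaqU_chart`, ★`divP_chart` ([Balaban1985BackgroundPropagators] (3.8)–(3.9) = [Balaban1985RegularSpaces] (1.1)–(1.2) under the chart); §2 ★`inU2cur_of_divSmall`,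
`inU2cur_of_regPr` ([Balaban1985Variational] (2)/(14) current clause from `RegPr`, `η = L^{−(K−n)}`, `lev ≡ K − n`); §3 ★★`prop6_T3`, `prop6_T3_H₁B` =
`B11Prop6Concrete.exists_solution_concrete(_H₁B)` at the objects with `hU`, `h14` DISCHARGED and the curved letters' bounds `norm_G` (Thm 3.13, N06(d = 3)), Prop. 4,
`norm_H₁` (Thm 3.12, N06(d = 3)), (20)-bound DISPLAYED.  HONEST SCOPE as there: bookkeeping + the PROVED Prop. 6 kernel; the operator letters are universally quantified.

References: T. Bałaban, CMP 102 (1985) 277–309 [Balaban1985Variational] ((2) p.278, (14) p.280, (20) p.281, (28) p.282, (103) p.293, (111) p.294, (115)–(117) p.295,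
Prop. 6 pp.295–296); CMP 99 (1985) 75–102 [Balaban1985RegularSpaces] ((1.1)–(1.2) p.76, (1.9) p.77, (1.37) p.82); CMP 99 (1985) 389–434
[Balaban1985BackgroundPropagators] ((3.3) p.390, (3.8)–(3.9) p.392, Thms 3.12–3.13 pp.420–423); CMP 98 (1985) 17–51 [Balaban1985Averaging] ((9) p.19, (19) p.21).
-/

noncomputable section

open scoped Matrix.Norms.L2Operator

namespace Summit.QuantumFields.YangMills.Theorems.Prop7SectET3ObjectsPd

open Literature.MathematicalPhysics.QuantumFieldTheory.Balaban1983to89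
open T3ContinuumYM3Torus T3PrintedRegularMinimiser
open B4Sect5Torus (TSite)
open B9SectCLatticeCarrier (Bond)
open B10Eq27TorusAxialLog (unitsField toUField val_unitsField holT holT_plaqWord)
open B10Eq68TorusRegularity (covDivT covDerivT plaqFT)
open B11Prop6Concrete (IsUnitaryBg InU2cur)
open B11Eq90V0primeCurrent (Tsh Ucur)
open B9Eq39Adjoint (R covDstar divP divPη plaqU)
open B11Eq27Current (plaqField)
open B11Eq115Space (levWeight NegSize Space115)
open B11Eq111FrakG (nabla115)
open B11Eq98CurrentSlot (Jcur)
open B13Contraction113 (QuadAnalytic)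
open B11Prop6Concrete (exists_solution_concrete exists_solution_concrete_H₁B)
open B7Eq78Linearization (conjR)
open Summit.QuantumFields.YangMills.Theorems.Prop7SectET3Objects (three_L_cast)

variable {F : T3Family} {n K : ℕ}

/-! ## §1 The background read on lit-balaban's bonds through a site chart -/

section Chart

variable {Pd : Fin (F.P K).d → ℕ} (e : Site (F.P K) 0 ≃ TSite (F.P K).d Pd)

/-- **The reading is G-valued, G = SU(2) ⊂ U(2)**: `U₀(b)⁻¹ = U₀(b)^*` bondwise — lit-balaban's `IsUnitaryBg` (the hypothesis `hU` of `norm_Jcur_le` ∕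
`exists_solution_concrete`), by `rfl` on `Unitary.toUnits`. [cite: Balaban1985Variational, p.277 («G ⊂ U(N)»), (28) p.282] -/
theorem isUnitaryBg_T3 (U₀ : GaugeField (F.P K) 0 (Matrix.specialUnitaryGroup (Fin 2) ℂ)) :
    IsUnitaryBg (fun b : Bond (F.P K).d Pd => unitsField (toUField U₀) ⟨e.symm b.1, b.2⟩) := by
  intro b
  rfl

/- The chart intertwines the unit steps: `e (x + e_μ) = (e x) + e_μ` (the ONE property of ★w5's chart of record used below). -/
variable (he : ∀ (x : Site (F.P K) 0) (μ : Fin (F.P K).d), e (x.shift μ) = B9Eq33CovDerivVector.shiftEquiv μ (e x))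

include he in
/-- lit-balaban's shift `T_μ` ([Balaban1985BackgroundPropagators] (3.3): `x ↦ x + e_μ`, `B11Eq90V0primeCurrent.Tsh`) read through the chart is the route's `Site.shift`.
[folklore] [cite: Balaban1985BackgroundPropagators, (3.3) p.390] -/
theorem tsh_apply (x : Site (F.P K) 0) (μ : Fin (F.P K).d) :
    Tsh (Pd := Pd) μ (e x) = e (x.shift μ) := by
  rw [he]

include he in
/-- … and its inverse `x ↦ x − e_μ` is the route's `Site.unshift`. [folklore] [cite: Balaban1985BackgroundPropagators, (3.5) p.391] -/
theorem tsh_symm_apply (x : Site (F.P K) 0) (μ : Fin (F.P K).d) :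
    (Tsh (Pd := Pd) μ).symm (e x) = e (x.unshift μ) := by
  rw [Equiv.symm_apply_eq, tsh_apply e he, Site.shift_unshift]

include he in
/-- **Plaquette variables agree**: lit-balaban's `U(∂p_{μν}(x)) = U_μ(x)U_ν(x+e_μ)U_μ(x+e_ν)⁻¹U_ν(x)⁻¹` (`B9Eq39Adjoint.plaqU`) of the reading, at `e x`, is the route's
transport along the plaquette word `(+e_μ, +e_ν, −e_μ, −e_ν)` from `x` (`B10Eq27TorusAxialLog.holT_plaqWord`). [cite: Balaban1985Averaging, (9) p.19; Balaban1985BackgroundPropagators, (3.1) p.390] -/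
theorem plaqU_chart (U₀ : GaugeField (F.P K) 0 (Matrix.specialUnitaryGroup (Fin 2) ℂ)) (μ ν : Fin (F.P K).d) (x : Site (F.P K) 0) :
    plaqU Tsh (Ucur (fun b : Bond (F.P K).d Pd => unitsField (toUField U₀) ⟨e.symm b.1, b.2⟩)) μ ν (e x)
      = holT (unitsField (toUField U₀)) x (B7Prop1Explicit.plaqWord μ ν) := by
  rw [holT_plaqWord]
  simp only [plaqU, Ucur, tsh_apply e he, Equiv.symm_apply_apply]

include he in
/-- **THE COVARIANT DIVERGENCE OF THE PLAQUETTE FIELD AGREES** (the one row with content): lit-balaban's (3.9) `(D^{1*}F)_μ(x) = Σ_{ν<μ}(D*_νF_{νμ})(x) −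
Σ_{ν>μ}(D*_νF_{μν})(x)` with the backward covariant derivative (3.8) `(D*_νG)(x) = R(U(x−e_ν, x)⁻¹)G(x−e_ν) − G(x)` applied to `F = ∂U₀` (`B9Eq39Adjoint.divP Tsh (Ucur ·)
(B11Eq27Current.plaqField …)`), evaluated at `e x`, IS the route's [Balaban1985RegularSpaces] (1.1)–(1.2) `B10Eq68TorusRegularity.covDivT 1 (unitsField (toUField U₀)) μ x`
— same signs, same transporter `R = conjR`, `η = 1`. [cite: Balaban1985BackgroundPropagators, (3.8)-(3.9) p.392; Balaban1985RegularSpaces, (1.1)-(1.2) p.76] -/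
theorem divP_chart (U₀ : GaugeField (F.P K) 0 (Matrix.specialUnitaryGroup (Fin 2) ℂ)) (μ : Fin (F.P K).d) (x : Site (F.P K) 0) :
    divP Tsh (Ucur (fun b : Bond (F.P K).d Pd => unitsField (toUField U₀) ⟨e.symm b.1, b.2⟩))
        (plaqField Tsh (Ucur (fun b : Bond (F.P K).d Pd => unitsField (toUField U₀) ⟨e.symm b.1, b.2⟩)))
        μ (e x)
      = covDivT 1 (unitsField (toUField U₀)) μ x := by
  have hP : ∀ (κ κ' : Fin (F.P K).d) (y : Site (F.P K) 0),
      plaqField Tsh (Ucur (fun b : Bond (F.P K).d Pd => unitsField (toUField U₀) ⟨e.symm b.1, b.2⟩))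
        κ κ' (e y) = plaqFT (unitsField (toUField U₀)) κ κ' y := by
    intro κ κ' y
    simp only [plaqField, plaqFT, plaqU_chart e he]
  have hD : ∀ (κ : Fin (F.P K).d) (G : Site (F.P K) 0 → Matrix (Fin 2) (Fin 2) ℂ)
      (G' : TSite (F.P K).d Pd → Matrix (Fin 2) (Fin 2) ℂ),
      (∀ y, G' (e y) = G y) →
      covDstar Tsh (Ucur (fun b : Bond (F.P K).d Pd => unitsField (toUField U₀) ⟨e.symm b.1, b.2⟩))
        κ G' (e x) = covDerivT 1 (unitsField (toUField U₀)) κ G x := by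
    intro κ G G' hG
    simp only [covDstar, covDerivT, Ucur, tsh_symm_apply e he, Equiv.symm_apply_apply, hG, inv_one, one_smul]
    rfl
  rw [covDivT, ← Finset.filter_gt_eq_Iio, ← Finset.filter_lt_eq_Ioi, Finset.sum_filter, Finset.sum_filter, divP]
  congr 1
  · refine Finset.sum_congr rfl fun ν _ => ?_
    split_ifs with h
    · exact hD ν _ _ (hP ν μ)
    · rfl
  · refine Finset.sum_congr rfl fun ν _ => ?_
    split_ifs with h
    · exact hD ν _ _ (hP μ ν)
    · rfl

/-! ## §2 The (14)-current clause `InU2cur` from the route's divergence clause `DivSmall` -/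

include he in
/-- **(2)/(14)'s CURRENT CLAUSE AT THE T³ OBJECTS**: the route's divergence clause `DivSmall F n K a U₀` (`‖(D^{1*}_{U₀}∂U₀)(b)‖ < a·L^{−3(K−n)}` at every bond of
the finest lattice, [Balaban1985RegularSpaces] (1.9) at the top scale) gives lit-balaban's `InU2cur L η lev₀ a (reading)` — *«|(D*_U∂U)(b)| < ε₀η²(Lʲη)⁻³ for b ∈ Ω_j»*
read bondwise with `η = L^{−(K−n)}`, `lev₀ ≡ K − n` (so `(Lʲη)⁻³ = 1` and `η⁻¹·‖D^{1*}…‖ ≤ a·η²`). [cite: Balaban1985Variational, (2) p.278, (14) p.280; Balaban1985RegularSpaces, (1.9) p.77] -/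
theorem inU2cur_of_divSmall {a : ℝ} (U₀ : GaugeField (F.P K) 0 (Matrix.specialUnitaryGroup (Fin 2) ℂ)) (h : DivSmall F n K a U₀) :
    InU2cur (F.L : ℝ) (((F.L : ℝ)⁻¹) ^ (K - n)) (fun _ : Bond (F.P K).d Pd => K - n) a
      (fun b : Bond (F.P K).d Pd => unitsField (toUField U₀) ⟨e.symm b.1, b.2⟩) := by
  intro b
  obtain ⟨y, μ⟩ := b
  obtain ⟨x, rfl⟩ : ∃ x, e x = y := ⟨e.symm y, e.apply_symm_apply y⟩
  have hL : (0 : ℝ) < (F.L : ℝ) := by have := F.hL.2; exact_mod_cast (by omega : 0 < F.L)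
  have hη : (0 : ℝ) < ((F.L : ℝ)⁻¹) ^ (K - n) := by positivity
  rw [divPη, divP_chart e he U₀ μ x, norm_smul, norm_inv, Complex.norm_real, Real.norm_of_nonneg hη.le,
    B11Eq115Space.levWeight_apply, pow_one]
  have hw : (F.L : ℝ) ^ (K - n) * ((F.L : ℝ)⁻¹) ^ (K - n) = 1 := by
    rw [← mul_pow, mul_inv_cancel₀ hL.ne', one_pow]
  rw [hw, inv_one, one_pow, mul_one]
  have hb : ‖covDivT 1 (unitsField (toUField U₀)) μ x‖ ≤ a * (((F.L : ℝ)⁻¹) ^ (K - n)) ^ 3 := by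
    have h' := (h ⟨x, μ⟩).le
    rwa [pow_mul'] at h'
  calc (((F.L : ℝ)⁻¹) ^ (K - n))⁻¹ * ‖covDivT 1 (unitsField (toUField U₀)) μ x‖
      ≤ (((F.L : ℝ)⁻¹) ^ (K - n))⁻¹ * (a * (((F.L : ℝ)⁻¹) ^ (K - n)) ^ 3) :=
        mul_le_mul_of_nonneg_left hb (inv_nonneg.2 hη.le)
    _ = a * (((F.L : ℝ)⁻¹) ^ (K - n)) ^ 2 := by
        field_simp

include he in
/-- **`U₀ ∈ 𝔘_k(a)` IN FULL (`RegPr F n K a U₀`) puts the reading in lit-balaban's current class (2) of radius `a`** (its divergence half; the plaquette half is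
not used by Sect. E). [cite: Balaban1985Variational, (2) p.278, (14) p.280] -/
theorem inU2cur_of_regPr {a : ℝ} (U₀ : GaugeField (F.P K) 0 (Matrix.specialUnitaryGroup (Fin 2) ℂ)) (h : RegPr F n K a U₀) :
    InU2cur (F.L : ℝ) (((F.L : ℝ)⁻¹) ^ (K - n)) (fun _ : Bond (F.P K).d Pd => K - n) a
      (fun b : Bond (F.P K).d Pd => unitsField (toUField U₀) ⟨e.symm b.1, b.2⟩) :=
  inU2cur_of_divSmall e he U₀ h.divSmall

/-! ## §3 Proposition 6 ([Balaban1985Variational] p. 295) AT THE T³ OBJECTS, the curved letters displayed -/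

include he in
/-- **PROPOSITION 6 (i)/(ii) AT THE T³ OBJECTS OF THE ROUTE** (`B11Prop6Concrete.exists_solution_concrete` with `hU`, `h14` DISCHARGED from `RegPr F n K (C₁B₃ε₁) U₀`):
for the letters `𝒢 = 𝔊(U₀) : |·|₍₋₃₎ → (115)_{U₀}` with ‖𝒢f‖ ≤ B₀‖f‖ (*«By Theorem 3.13 of [5]»*, (117) — `SectEDatum.norm_G`, N06(d = 3), DISPLAYED as `h𝒢`),
`W = (δ/δA′)V` quadratic-analytic with `(C₄, a₃)` (Prop. 4 (97)–(98), DISPLAYED as `hW`), constants with `3L ≤ B₃`, `2B₀C₁B₃ε₁ ≤ ε₄`, `4ε₄ ≤ a₃`, `16B₀C₄ε₄ ≤ 1`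
(`ε₄ ≤ a₄` unfolded), and any `𝔄 ∈ (115)_{U₀}` with ‖𝔄‖ < 2·3L·B₀C₁ε₁ ((103)): Eq. (111) `A₁ + 𝒢J(U₀) + 𝒢(W(A₁ + 𝔄)) = 0` with the CONCRETE current `J(U₀) = Jcur`
((28) derived in lit-balaban) has a solution in the open (115)-ball of radius `ε₄`, of size `< 3B₀C₁B₃ε₁`, and every solution in that ball equals it.  Scale
letters `L = F.L`, `η = L^{−(K−n)}`, `lev ≡ K − n`; the two `Fact`s are `0 < L`, `0 < η`. [cite: Balaban1985Variational, Prop. 6 p.295, (111) p.294, (117) p.295] -/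
theorem prop6_T3 [Fact (0 < (F.L : ℝ))] [Fact (0 < ((F.L : ℝ)⁻¹) ^ (K - n))] {B₀ C₄ a₃ C₁ B₃ ε₁ ε₄ : ℝ}
    (U₀ : GaugeField (F.P K) 0 (Matrix.specialUnitaryGroup (Fin 2) ℂ))
    {𝒢 : NegSize (F.L : ℝ) (((F.L : ℝ)⁻¹) ^ (K - n)) (fun _ : Bond (F.P K).d Pd => K - n) 3
            (Matrix (Fin 2) (Fin 2) ℂ) →L[ℂ]
          Space115 (F.L : ℝ) (((F.L : ℝ)⁻¹) ^ (K - n)) (fun _ : Bond (F.P K).d Pd => K - n)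
            (fun _ : Bond (F.P K).d Pd × Fin (F.P K).d => K - n)
            (nabla115 (((F.L : ℝ)⁻¹) ^ (K - n))
              (fun b : Bond (F.P K).d Pd => unitsField (toUField U₀) ⟨e.symm b.1, b.2⟩))}
    {W : Space115 (F.L : ℝ) (((F.L : ℝ)⁻¹) ^ (K - n)) (fun _ : Bond (F.P K).d Pd => K - n)
            (fun _ : Bond (F.P K).d Pd × Fin (F.P K).d => K - n)
            (nabla115 (((F.L : ℝ)⁻¹) ^ (K - n))
              (fun b : Bond (F.P K).d Pd => unitsField (toUField U₀) ⟨e.symm b.1, b.2⟩)) →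
          NegSize (F.L : ℝ) (((F.L : ℝ)⁻¹) ^ (K - n)) (fun _ : Bond (F.P K).d Pd => K - n) 3
            (Matrix (Fin 2) (Fin 2) ℂ)}
    (h𝒢 : ∀ f, ‖𝒢 f‖ ≤ B₀ * ‖f‖) (hW : QuadAnalytic W C₄ a₃) (hB₀ : 0 < B₀) (hC₄ : 0 < C₄) (hC₁ : 0 < C₁) (hB₃ : 0 < B₃) (hε₁ : 0 < ε₁)
    (hdLB₃ : (3 : ℝ) * F.L ≤ B₃) (h1 : 2 * B₀ * C₁ * B₃ * ε₁ ≤ ε₄) (h2 : 4 * ε₄ ≤ a₃) (h3 : 16 * B₀ * C₄ * ε₄ ≤ 1)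
    (hreg : RegPr F n K (C₁ * B₃ * ε₁) U₀)
    {𝔄 : Space115 (F.L : ℝ) (((F.L : ℝ)⁻¹) ^ (K - n)) (fun _ : Bond (F.P K).d Pd => K - n)
            (fun _ : Bond (F.P K).d Pd × Fin (F.P K).d => K - n)
            (nabla115 (((F.L : ℝ)⁻¹) ^ (K - n))
              (fun b : Bond (F.P K).d Pd => unitsField (toUField U₀) ⟨e.symm b.1, b.2⟩))}
    (h𝔄 : ‖𝔄‖ < 2 * ((3 : ℝ) * F.L) * B₀ * C₁ * ε₁) :
    ∃ A₁ : Space115 (F.L : ℝ) (((F.L : ℝ)⁻¹) ^ (K - n)) (fun _ : Bond (F.P K).d Pd => K - n)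
            (fun _ : Bond (F.P K).d Pd × Fin (F.P K).d => K - n)
            (nabla115 (((F.L : ℝ)⁻¹) ^ (K - n))
              (fun b : Bond (F.P K).d Pd => unitsField (toUField U₀) ⟨e.symm b.1, b.2⟩)),
      ‖A₁‖ < ε₄ ∧
      A₁ + 𝒢 (Jcur fun b : Bond (F.P K).d Pd => unitsField (toUField U₀) ⟨e.symm b.1, b.2⟩)
          + 𝒢 (W (A₁ + 𝔄)) = 0 ∧
      ‖A₁‖ < 3 * B₀ * C₁ * B₃ * ε₁ ∧
      ∀ A₁' : Space115 (F.L : ℝ) (((F.L : ℝ)⁻¹) ^ (K - n)) (fun _ : Bond (F.P K).d Pd => K - n)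
            (fun _ : Bond (F.P K).d Pd × Fin (F.P K).d => K - n)
            (nabla115 (((F.L : ℝ)⁻¹) ^ (K - n))
              (fun b : Bond (F.P K).d Pd => unitsField (toUField U₀) ⟨e.symm b.1, b.2⟩)),
        ‖A₁'‖ < ε₄ →
        A₁' + 𝒢 (Jcur fun b : Bond (F.P K).d Pd => unitsField (toUField U₀) ⟨e.symm b.1, b.2⟩)
            + 𝒢 (W (A₁' + 𝔄)) = 0 →
        A₁' = A₁ := by
  have h𝔄' : ‖𝔄‖ < 2 * (((F.P K).d : ℝ) * (F.L : ℝ)) * B₀ * C₁ * ε₁ := by simpa using h𝔄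
  exact exists_solution_concrete _ h𝒢 hW hB₀ hC₄ hC₁ hB₃ hε₁ (three_L_cast hdLB₃) h1 h2 h3 (isUnitaryBg_T3 e U₀)
    (inU2cur_of_regPr e he U₀ hreg) h𝔄'

include he in
/-- **PROPOSITION 6 (i) AT THE T³ OBJECTS WITH THE DATUM `𝔄 := H₁(U₀)B`** (`B11Prop6Concrete.exists_solution_concrete_H₁B`): as `prop6_T3`, the letter
`H₁(U₀) : (β → M₂(ℂ)) → (115)_{U₀}` with ‖H₁(U₀)b‖ ≤ B₀‖b‖ ([Balaban1985BackgroundPropagators] Thm 3.12 as used in (103) — `SectEDatum.norm_H₁`, N06(d = 3), DISPLAYED as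
`hH₁`) and the constraint configuration `B` of (20) with `|B| < 2·3L·C₁ε₁` (*«hence |B| < 2dLC₁ε₁»* ⇐ [Balaban1985RegularSpaces] (1.37), DISPLAYED as `hB`; `β` = the
coarse bonds carrying `B`, abstract): Eq. (111) *«A₁ + 𝔊J + 𝔊((δ/δA′)V)(A₁ + H₁B) = 0»* has exactly one solution in the (115)-ball `ε₄`, of size `< 3B₀C₁B₃ε₁` ((103)
derived in lit-balaban). [cite: Balaban1985Variational, Prop. 6 p.295, (103) p.293, (20) p.281] -/
theorem prop6_T3_H₁B [Fact (0 < (F.L : ℝ))] [Fact (0 < ((F.L : ℝ)⁻¹) ^ (K - n))] {B₀ C₄ a₃ C₁ B₃ ε₁ ε₄ : ℝ}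
    (U₀ : GaugeField (F.P K) 0 (Matrix.specialUnitaryGroup (Fin 2) ℂ))
    {𝒢 : NegSize (F.L : ℝ) (((F.L : ℝ)⁻¹) ^ (K - n)) (fun _ : Bond (F.P K).d Pd => K - n) 3
            (Matrix (Fin 2) (Fin 2) ℂ) →L[ℂ]
          Space115 (F.L : ℝ) (((F.L : ℝ)⁻¹) ^ (K - n)) (fun _ : Bond (F.P K).d Pd => K - n)
            (fun _ : Bond (F.P K).d Pd × Fin (F.P K).d => K - n)
            (nabla115 (((F.L : ℝ)⁻¹) ^ (K - n))
              (fun b : Bond (F.P K).d Pd => unitsField (toUField U₀) ⟨e.symm b.1, b.2⟩))}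
    {W : Space115 (F.L : ℝ) (((F.L : ℝ)⁻¹) ^ (K - n)) (fun _ : Bond (F.P K).d Pd => K - n)
            (fun _ : Bond (F.P K).d Pd × Fin (F.P K).d => K - n)
            (nabla115 (((F.L : ℝ)⁻¹) ^ (K - n))
              (fun b : Bond (F.P K).d Pd => unitsField (toUField U₀) ⟨e.symm b.1, b.2⟩)) →
          NegSize (F.L : ℝ) (((F.L : ℝ)⁻¹) ^ (K - n)) (fun _ : Bond (F.P K).d Pd => K - n) 3
            (Matrix (Fin 2) (Fin 2) ℂ)}
    (h𝒢 : ∀ f, ‖𝒢 f‖ ≤ B₀ * ‖f‖) (hW : QuadAnalytic W C₄ a₃) (hB₀ : 0 < B₀) (hC₄ : 0 < C₄) (hC₁ : 0 < C₁) (hB₃ : 0 < B₃) (hε₁ : 0 < ε₁)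
    (hdLB₃ : (3 : ℝ) * F.L ≤ B₃) (h1 : 2 * B₀ * C₁ * B₃ * ε₁ ≤ ε₄) (h2 : 4 * ε₄ ≤ a₃) (h3 : 16 * B₀ * C₄ * ε₄ ≤ 1)
    (hreg : RegPr F n K (C₁ * B₃ * ε₁) U₀)
    {β : Type} [Fintype β]
    (H₁ : (β → Matrix (Fin 2) (Fin 2) ℂ) →L[ℂ]
          Space115 (F.L : ℝ) (((F.L : ℝ)⁻¹) ^ (K - n)) (fun _ : Bond (F.P K).d Pd => K - n)
            (fun _ : Bond (F.P K).d Pd × Fin (F.P K).d => K - n)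
            (nabla115 (((F.L : ℝ)⁻¹) ^ (K - n))
              (fun b : Bond (F.P K).d Pd => unitsField (toUField U₀) ⟨e.symm b.1, b.2⟩)))
    (hH₁ : ∀ b, ‖H₁ b‖ ≤ B₀ * ‖b‖) {B : β → Matrix (Fin 2) (Fin 2) ℂ} (hB : ‖B‖ < 2 * ((3 : ℝ) * F.L) * (C₁ * ε₁)) :
    ∃ A₁ : Space115 (F.L : ℝ) (((F.L : ℝ)⁻¹) ^ (K - n)) (fun _ : Bond (F.P K).d Pd => K - n)
            (fun _ : Bond (F.P K).d Pd × Fin (F.P K).d => K - n)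
            (nabla115 (((F.L : ℝ)⁻¹) ^ (K - n))
              (fun b : Bond (F.P K).d Pd => unitsField (toUField U₀) ⟨e.symm b.1, b.2⟩)),
      ‖A₁‖ < ε₄ ∧
      A₁ + 𝒢 (Jcur fun b : Bond (F.P K).d Pd => unitsField (toUField U₀) ⟨e.symm b.1, b.2⟩)
          + 𝒢 (W (A₁ + H₁ B)) = 0 ∧
      ‖A₁‖ < 3 * B₀ * C₁ * B₃ * ε₁ ∧
      ∀ A₁' : Space115 (F.L : ℝ) (((F.L : ℝ)⁻¹) ^ (K - n)) (fun _ : Bond (F.P K).d Pd => K - n)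
            (fun _ : Bond (F.P K).d Pd × Fin (F.P K).d => K - n)
            (nabla115 (((F.L : ℝ)⁻¹) ^ (K - n))
              (fun b : Bond (F.P K).d Pd => unitsField (toUField U₀) ⟨e.symm b.1, b.2⟩)),
        ‖A₁'‖ < ε₄ →
        A₁' + 𝒢 (Jcur fun b : Bond (F.P K).d Pd => unitsField (toUField U₀) ⟨e.symm b.1, b.2⟩)
            + 𝒢 (W (A₁' + H₁ B)) = 0 →
        A₁' = A₁ := by
  have hB' : ‖B‖ < 2 * (((F.P K).d : ℝ) * (F.L : ℝ)) * (C₁ * ε₁) := by simpa using hB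
  exact exists_solution_concrete_H₁B _ h𝒢 hW hB₀ hC₄ hC₁ hB₃ hε₁ (three_L_cast hdLB₃) h1 h2 h3 (isUnitaryBg_T3 e U₀)
    (inU2cur_of_regPr e he U₀ hreg) H₁ hH₁ hB'

end Chart

end Summit.QuantumFields.YangMills.Theorems.Prop7SectET3ObjectsPd

end
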